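import Mathlib
import HarnessLib
import Summits.NavierStokesRegularity.NavierStokesRegularity.Theorems.UnthreadedRigidityDoorUnthreadedRigidityThreadingJetsSlice
import Summits.NavierStokesRegularity.NavierStokesRegularity.Theorems.UnthreadedRigidityDoorUnthreadedRigidityVirialHornDegreeTwoRung
import Summits.NavierStokesRegularity.NavierStokesRegularity.Theorems.UnthreadedRigidityDoorUnthreadedRigidityProfileHornCompositions

/-!
# Route `UnthreadedRigidityDoor`, item `UnthreadedRigidity` (W2, stmt-NavierStokesRegularity-27585) — THREADING JETS, RUNGS RE-BASED:
# the separable slice rungs of LINE g10-2 «PROFILE HORN» / g11-1 «VIRIAL HORN» now wait only on SLICE identities between explicit fields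

Seat ns-crc-p1 g8, `--supports stmt-NavierStokesRegularity-27585 --as helper`.  One-line compositions BY NAME of this seat's reductions
(`…ThreadingJetsSlice`, file 3/3: `orderTwoVirialIdentity_of_sliceLaw`, `hornIdentityTwo_of_slice`) with g7's VIRIAL HORN compositions
(`…VirialHornCompositions` p697225: `separableOrderTwoRigidityL_of_identity`; `…VirialHornDegreeTwoRung` p701327:
`separableShellOrderTwoRigidity_of_virialIdentity`) and PROFILE HORN compositions (`…ProfileHornCompositions` p692802:
`separableShellOrderTwoRigidity_of_identity`).  Kept in a separate module because those composition files import the route file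
(theses cone), which the jet dictionary and the slice reductions do not need.

* `separableOrderTwoRigidityL_of_sliceLaw : OrderTwoSliceLaw → AngularLemma → VirialHorn.SeparableOrderTwoRigidityL` (all degrees);
* `separableShellOrderTwoRigidity_of_sliceLaw : OrderTwoSliceLaw → ProfileHorn.SeparableShellOrderTwoRigidity` — AT `l = 2` THE SEPARABLE
  SLICE RUNG WAITS ONLY ON ONE IDENTITY BETWEEN EXPLICIT FIELDS (S-C `angularLemma_two`, S-V, S-Z, THEOREM PHR all discharged by g7);
* `separableShellOrderTwoRigidity_of_hornSlice : HornSliceIdentityTwo → ProfileHorn.SeparableShellOrderTwoRigidity` (the same rung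
  through the PROFILE HORN line).

HONEST FRAMING: bookkeeping of two RUNG lines on the wall item; the slice identities themselves are NOT proved here; nothing here bears on
`UnthreadedRigidity` (27585), the door Target, W2 or Navier–Stokes regularity; no summit statement is proved.  MODEL/rung work. [folklore]
-/

noncomputable section

-- the summit and its single sub-problem share the name (CONVENTIONS §1), as in every Theorems file
set_option linter.dupNamespace false

namespace Summit.NavierStokesRegularity.NavierStokesRegularity.Theorems.UnthreadedRigidity.ThreadingJets

open Summit.NavierStokesRegularity.NavierStokesRegularity.Theorems.UnthreadedRigidity.ProfileHorn
  (SeparableShellOrderTwoRigidity separableShellOrderTwoRigidity_of_identity)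
open Summit.NavierStokesRegularity.NavierStokesRegularity.Theorems.UnthreadedRigidity.VirialHorn
  (AngularLemma SeparableOrderTwoRigidityL separableOrderTwoRigidityL_of_identity separableShellOrderTwoRigidity_of_virialIdentity)

/-- The separable slice rung IN EVERY DEGREE re-based on the slice law: `OrderTwoSliceLaw → AngularLemma → SeparableOrderTwoRigidityL`
(g7's `separableOrderTwoRigidityL_of_identity`, S-V and S-Z discharged there). [folklore] -/
theorem separableOrderTwoRigidityL_of_sliceLaw (hL : OrderTwoSliceLaw) (hC : AngularLemma) : SeparableOrderTwoRigidityL :=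
  separableOrderTwoRigidityL_of_identity (orderTwoVirialIdentity_of_sliceLaw hL) hC

/-- **At `l = 2` the separable slice rung waits ONLY on an identity between explicit fields**:
`OrderTwoSliceLaw → ProfileHorn.SeparableShellOrderTwoRigidity` (g7's `separableShellOrderTwoRigidity_of_virialIdentity`, which uses
`angularLemma_two`, S-V, S-Z and the degree-two dictionary). [folklore] -/
theorem separableShellOrderTwoRigidity_of_sliceLaw (hL : OrderTwoSliceLaw) : SeparableShellOrderTwoRigidity :=
  separableShellOrderTwoRigidity_of_virialIdentity (orderTwoVirialIdentity_of_sliceLaw hL)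

/-- The same rung through the PROFILE HORN line: `HornSliceIdentityTwo → ProfileHorn.SeparableShellOrderTwoRigidity`
(g7's `separableShellOrderTwoRigidity_of_identity`, THEOREM PHR and S-Z discharged there). [folklore] -/
theorem separableShellOrderTwoRigidity_of_hornSlice (hL : HornSliceIdentityTwo) : SeparableShellOrderTwoRigidity :=
  separableShellOrderTwoRigidity_of_identity (hornIdentityTwo_of_slice hL)


end Summit.NavierStokesRegularity.NavierStokesRegularity.Theorems.UnthreadedRigidity.ThreadingJets

end
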